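import Summits.BirchSwinnertonDyer.Rank1Residual.ManinAdditive.ShimuraKernelCyclic
import Literature.NumberTheory.EllipticCurves.PeriodLatticeGamma1QuotientProofs
import Mathlib.LinearAlgebra.FreeModule.PID
import HarnessLib

/-!
# E-es-190: the Shimura quotient `Λ₀(f)/Λ₁(f)` is CYCLIC iff no prime `ℓ` has `Λ₁(f) ⊆ ℓΛ₀(f)` (lattice algebra, fact-free)
(route `ManinLocalTwoThree`, crux C2 `ManinOddAtFour` stmt-BirchSwinnertonDyer-22967; cell bsd-f2-manin, prover seat p2 gen 23;
`--supports stmt-BirchSwinnertonDyer-22967`; es g40 row E-es-190 `ShimuraKernelCyclicOfNoPrimeInclusion` (MEMO-es §61.4 support row),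
the lattice-algebra half of desc g26 row 2 `ShimuraCyclic.ShimuraKernelCyclic`)

For a rational newform `f ∈ S₂(Γ₀(N))` the period lattice `Λ₀(f)` is a rank-`2` `ℤ`-lattice (`isZLattice_periodLattice_holds`) and the
`Γ₁(N)`-period lattice satisfies `φ(N)Λ₀(f) ⊆ Λ₁(f) ⊆ Λ₀(f)` (`totient_mul_mem_periodLatticeGamma1`, `periodLatticeGamma1_le_periodLattice`),
so `Λ₀/Λ₁` is a finite abelian group on two generators.  THIS FILE proves the elementary-divisor dichotomy behind es's / desc's split of
«the Shimura kernel `ker(E₁ → E₀) ≅ Λ₀/Λ₁` is cyclic» into `ℓ`-primary parts: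

* `exists_generator_of_forall_prime` — the abstract lemma: a full-rank submodule `N₁` of a free `ℤ`-module `M` of rank `2` not contained in
  `ℓM` for any prime `ℓ` has cyclic quotient, `M = ℤz₀ + N₁` (Smith normal form `N₁ = a₀ℤb₀ ⊕ a₁ℤb₁`; a common prime factor of `a₀, a₁`
  would put `N₁` inside `ℓM`, so `a₀, a₁` are coprime and `z₀ = b₀ + b₁` generates `M/N₁ ≅ ℤ/a₀ × ℤ/a₁` by the Chinese remainder theorem);
* `not_prime_le_of_cyclic` — if `Λ₀ = ℤz₀ + Λ₁` then `Λ₁ ⊄ ℓΛ₀` for every prime `ℓ` (desc's parity lemma `not_cyclic_and_insideTwice` at any prime);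
* **`cyclic_of_forall_prime_not_le`** — conversely, if `Λ₁ ⊄ ℓΛ₀` for every prime `ℓ`, then `Λ₀ = ℤz₀ + Λ₁` for some period `z₀`
  (verbatim the body of desc's `NewformShimuraKernelCyclic` / `ShimuraKernelCyclic`); `cyclic_iff_forall_prime_not_le`;
* datum forms and glue: `cyclic_of_forall_prime_not_le_datum`, `shimuraKernelCyclic_body_of_parts` (desc row 2's body at `D₀` from
  its `2`-part «`Λ₁ ⊄ 2Λ₀`», supplied per datum by p3's `KummerValues.not_halfIndex_of_modularity_of_kummerValues`, and its odd part
  «`Λ₁ ⊄ ℓΛ₀`, `ℓ` odd», E-es-189), `newformShimuraKernelCyclic_of_forall_prime_not_le` (row-level).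

UNCONDITIONAL lattice algebra; nothing about E-es-188/189, C2, Manin's conjecture or BSD is proved.  No definitions, no sorry.
[cite: Hungerford1974, Ch. II Thm. 1.6 and Ch. IV Thm. 6.1] [cite: Shimura1971, Thm. 7.14] [cite: LingOesterle1991, §1 and Thm. 1]
-/

set_option autoImplicit false
-- lint-debt: the directory name repeats the summit name (sibling precedent `ManinLocalTwoThreeKummerValuesHalfIndex.lean`)
set_option linter.dupNamespace false

noncomputable section

open scoped MatrixGroups
open CongruenceSubgroup WeierstrassCurve Literature.NumberTheory.EllipticCurves Literature.NumberTheory.EllipticCurves.ModularForms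
open Module

namespace Summit.BirchSwinnertonDyer.BirchSwinnertonDyer.Theorems.ManinLocalTwoThree.ShimuraKernelLattice

/-! ## §1 The abstract lattice lemma (rank `2`, Smith normal form, CRT) -/

/-- **A full-rank sublattice of `ℤ²` contained in no `ℓℤ²` has cyclic quotient.**  Let `M` be a free `ℤ`-module of rank `2`, `N₁ ≤ M` a submodule
containing `nM` for some `n ≠ 0` acting injectively, and suppose that for every prime `ℓ` some element of `N₁` is not an `ℓ`-th multiple in `M`.
Then `M = ℤz₀ + N₁` for some `z₀`.  (Smith normal form `N₁ = a₀ℤb₀ ⊕ a₁ℤb₁`, Mathlib `Submodule.exists_smith_normal_form_of_rank_eq`; the `aᵢ` are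
coprime; `z₀ = b₀ + b₁` and the Chinese remainder theorem.) [cite: Hungerford1974, Ch. II Thm. 1.6 and Ch. IV Thm. 6.1] -/
theorem exists_generator_of_forall_prime {M : Type*} [AddCommGroup M] [Module.Free ℤ M] [Module.Finite ℤ M]
    (hrank : Module.finrank ℤ M = 2) (N₁ : Submodule ℤ M) {n : ℤ} (hinj : Function.Injective fun x : M ↦ n • x)
    (hnM : ∀ x : M, n • x ∈ N₁) (h : ∀ ℓ : ℕ, ℓ.Prime → ∃ x ∈ N₁, ∀ y : M, x ≠ (ℓ : ℤ) • y) :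
    ∃ z₀ : M, ∀ x : M, ∃ k : ℤ, x - k • z₀ ∈ N₁ := by
  classical
  -- `N₁` has full rank: it contains the image of the injective map `x ↦ n • x`
  have hinj' : Function.Injective (n • (LinearMap.id : M →ₗ[ℤ] M)) := fun x y hxy ↦ hinj (by simpa using hxy)
  have hle : LinearMap.range (n • (LinearMap.id : M →ₗ[ℤ] M)) ≤ N₁ := by
    rintro _ ⟨x, rfl⟩
    simpa using hnM x
  have hrankN : Module.finrank ℤ N₁ = Module.finrank ℤ M := by
    refine le_antisymm (Submodule.finrank_le N₁) ?_
    calc Module.finrank ℤ M = Module.finrank ℤ (LinearMap.range (n • (LinearMap.id : M →ₗ[ℤ] M))) :=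
          (LinearMap.finrank_range_of_inj hinj').symm
      _ ≤ Module.finrank ℤ N₁ := Submodule.finrank_mono hle
  -- Smith normal form on `Fin 2`: `N₁ = a 0 • ℤ b 0 ⊕ a 1 • ℤ b 1`
  obtain ⟨b, a, ab, hab⟩ := Submodule.exists_smith_normal_form_of_rank_eq (N := N₁) (Module.finBasisOfFinrankEq ℤ M hrank) hrankN
  -- coordinates of an element of `N₁`
  have hcoordN : ∀ (y : N₁) (i : Fin 2), b.repr (y : M) i = ab.repr y i * a i := by
    intro y i
    have h1 : (y : M) = ∑ j, ab.repr y j • (a j • b j) := by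
      conv_lhs => rw [← ab.sum_repr y]
      simp only [Submodule.coe_sum, Submodule.coe_smul_of_tower, hab]
    rw [h1, map_sum]
    simp only [map_smul, Basis.repr_self, Finsupp.coe_finsetSum, Finset.sum_apply, Finsupp.smul_apply,
      Finsupp.single_apply, smul_eq_mul, mul_ite, mul_one, mul_zero, Finset.sum_ite_eq', Finset.mem_univ, if_true]
  -- membership criterion
  have hmem : ∀ x : M, x ∈ N₁ ↔ ∀ i, a i ∣ b.repr x i := by
    intro x
    constructor
    · intro hx i
      exact ⟨ab.repr ⟨x, hx⟩ i, by rw [hcoordN ⟨x, hx⟩ i, mul_comm]⟩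
    · intro hx
      choose t ht using hx
      have hsum : x = ∑ j, t j • ((ab j : N₁) : M) := by
        conv_lhs => rw [← b.sum_repr x]
        refine Finset.sum_congr rfl fun j _ ↦ ?_
        rw [hab, smul_smul, ht j, mul_comm]
      rw [hsum]
      exact N₁.sum_mem fun j _ ↦ N₁.smul_mem (t j) (ab j).2
  -- no prime divides both `a 0` and `a 1`
  have hcop : ∀ ℓ : ℕ, ℓ.Prime → ¬ ((ℓ : ℤ) ∣ a 0 ∧ (ℓ : ℤ) ∣ a 1) := by
    intro ℓ hℓ hall
    obtain ⟨x, hx, hxy⟩ := h ℓ hℓ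
    have hdiv : ∀ i, (ℓ : ℤ) ∣ b.repr x i := by
      intro i
      have hi := (hmem x).mp hx i
      fin_cases i
      · exact hall.1.trans hi
      · exact hall.2.trans hi
    choose t ht using hdiv
    refine hxy (∑ i, t i • b i) ?_
    calc x = ∑ i, b.repr x i • b i := (b.sum_repr x).symm
      _ = ∑ i, (ℓ : ℤ) • (t i • b i) := Finset.sum_congr rfl fun i _ ↦ by rw [smul_smul, ← ht i]
      _ = (ℓ : ℤ) • ∑ i, t i • b i := (Finset.smul_sum ..).symm
  have hgcd : IsCoprime (a 0) (a 1) := by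
    rw [Int.isCoprime_iff_gcd_eq_one]
    by_contra hne
    obtain ⟨p, hp, hpd⟩ := Nat.exists_prime_and_dvd hne
    exact hcop p hp ⟨(Int.natCast_dvd_natCast.mpr hpd).trans (Int.gcd_dvd_left _ _),
      (Int.natCast_dvd_natCast.mpr hpd).trans (Int.gcd_dvd_right _ _)⟩
  obtain ⟨u, v, huv⟩ := hgcd
  -- the generator `z₀ = b 0 + b 1`
  refine ⟨b 0 + b 1, fun x ↦ ?_⟩
  -- CRT: `k ≡ c₀ (mod a 0)`, `k ≡ c₁ (mod a 1)` for the coordinates `c₀, c₁` of `x`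
  obtain ⟨k, hk₀, hk₁⟩ : ∃ k : ℤ, a 0 ∣ b.repr x 0 - k ∧ a 1 ∣ b.repr x 1 - k :=
    ⟨b.repr x 1 * u * a 0 + b.repr x 0 * v * a 1,
      ⟨(b.repr x 0 - b.repr x 1) * u, by linear_combination (-(b.repr x 0)) * huv⟩,
      ⟨(b.repr x 1 - b.repr x 0) * v, by linear_combination (-(b.repr x 1)) * huv⟩⟩
  refine ⟨k, (hmem _).mpr fun i ↦ ?_⟩
  fin_cases i
  · simpa [Finsupp.single_apply] using hk₀
  · simpa [Finsupp.single_apply] using hk₁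

/-! ## §2 The period lattices: cyclic ⟺ no prime inclusion -/

variable {N : ℕ} [NeZero N] (f : CuspForm (Gamma0 N) 2)

/-- **`Λ₀ = ℤz₀ + Λ₁` excludes `Λ₁ ⊆ ℓΛ₀` for every prime `ℓ`** (desc's `not_cyclic_and_insideTwice` at an arbitrary prime: on a `ℤ`-basis
`b_i, b_j` of `Λ₀(f)` write `b_i = k_i z₀ + ℓ w_i`, `b_j = k_j z₀ + ℓ w_j`; coordinates give `k_i c_i ≡ 1`, `k_i c_j ≡ 0`, `k_j c_j ≡ 1 (mod ℓ)`
for `c = repr z₀`, impossible for a prime `ℓ`). [cite: Shimura1971, Thm. 7.14] -/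
theorem not_prime_le_of_cyclic (hf : IsNewform0 f) (hQ : coeffField f = ⊥) {z₀ : ℂ} (hz₀ : z₀ ∈ periodLattice f)
    (hcyc : ∀ z ∈ periodLattice f, ∃ (k : ℤ) (w : ℂ), w ∈ periodLatticeGamma1 f ∧ z = (k : ℂ) * z₀ + w)
    {ℓ : ℕ} (hℓ : ℓ.Prime) : ¬ (∀ z ∈ periodLatticeGamma1 f, ∃ w ∈ periodLattice f, z = (ℓ : ℂ) * w) := by
  -- adapted from desc g26 `ShimuraCyclic.not_cyclic_and_insideTwice` (`2 ↦ ℓ`)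
  intro hin
  obtain ⟨hdisc, hZ⟩ := isZLattice_periodLattice_holds (f := f) hf hQ
  haveI : DiscreteTopology ↥(AddSubgroup.toIntSubmodule (periodLattice f)) := hdisc
  haveI : IsZLattice ℝ (AddSubgroup.toIntSubmodule (periodLattice f)) := hZ
  haveI : Module.Free ℤ ↥(AddSubgroup.toIntSubmodule (periodLattice f)) :=
    ZLattice.module_free ℝ (AddSubgroup.toIntSubmodule (periodLattice f))
  haveI : Module.Finite ℤ ↥(AddSubgroup.toIntSubmodule (periodLattice f)) :=
    ZLattice.module_finite ℝ (AddSubgroup.toIntSubmodule (periodLattice f))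
  have hrank : Module.finrank ℤ ↥(AddSubgroup.toIntSubmodule (periodLattice f)) = 2 := by
    rw [ZLattice.rank ℝ (AddSubgroup.toIntSubmodule (periodLattice f)), Complex.finrank_real_complex]
  let z₀' : ↥(AddSubgroup.toIntSubmodule (periodLattice f)) := ⟨z₀, hz₀⟩
  have key : ∀ z : ↥(AddSubgroup.toIntSubmodule (periodLattice f)),
      ∃ (k : ℤ) (w : ↥(AddSubgroup.toIntSubmodule (periodLattice f))), z = k • z₀' + (ℓ : ℤ) • w := by
    intro z
    obtain ⟨k, w, hw₁, hz⟩ := hcyc z z.2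
    obtain ⟨w', hw', hw⟩ := hin w hw₁
    refine ⟨k, ⟨w', hw'⟩, Subtype.ext ?_⟩
    simp [z₀', zsmul_eq_mul, hz, hw]
  let b := Module.Free.chooseBasis ℤ ↥(AddSubgroup.toIntSubmodule (periodLattice f))
  have hcard : Fintype.card (Module.Free.ChooseBasisIndex ℤ ↥(AddSubgroup.toIntSubmodule (periodLattice f))) = 2 := by
    rw [← Module.finrank_eq_card_chooseBasisIndex, hrank]
  obtain ⟨i, j, hij⟩ := Fintype.exists_pair_of_one_lt_card (α :=
    Module.Free.ChooseBasisIndex ℤ ↥(AddSubgroup.toIntSubmodule (periodLattice f))) (by omega)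
  obtain ⟨ki, wi, hi⟩ := key (b i)
  obtain ⟨kj, wj, hj⟩ := key (b j)
  have ei := congrArg (fun v => b.repr v i) hi
  have eij := congrArg (fun v => b.repr v j) hi
  have ej := congrArg (fun v => b.repr v j) hj
  simp only [b.repr_self, map_add, map_zsmul, Finsupp.add_apply, Finsupp.smul_apply, smul_eq_mul,
    Finsupp.single_apply, if_true, if_neg hij] at ei eij ej
  -- divisibility at the prime `ℓ`
  have hℓ' : Prime (ℓ : ℤ) := Int.prime_iff_natAbs_prime.mpr (by simpa using hℓ)
  have h1 : ¬ (ℓ : ℤ) ∣ ki * b.repr z₀' i := by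
    rintro ⟨t, ht⟩
    exact hℓ'.not_dvd_one ⟨t + b.repr wi i, by linarith⟩
  have h2 : (ℓ : ℤ) ∣ ki * b.repr z₀' j := ⟨-(b.repr wi j), by linarith⟩
  have h3 : ¬ (ℓ : ℤ) ∣ kj * b.repr z₀' j := by
    rintro ⟨t, ht⟩
    exact hℓ'.not_dvd_one ⟨t + b.repr wj j, by linarith⟩
  rcases hℓ'.dvd_or_dvd h2 with h | h
  · exact h1 (dvd_mul_of_dvd_left h _)
  · exact h3 (dvd_mul_of_dvd_right h _)

/-- **E-es-190.  If `Λ₁(f) ⊄ ℓΛ₀(f)` for every prime `ℓ`, then `Λ₀(f)/Λ₁(f)` is cyclic**: `Λ₀(f) = ℤz₀ + Λ₁(f)` for some period `z₀`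
(verbatim the body of desc's `NewformShimuraKernelCyclic` / `ShimuraKernelCyclic`).  Proof: `Λ₀ ≅ ℤ²` (`isZLattice_periodLattice_holds`),
`φ(N)Λ₀ ⊆ Λ₁` (`totient_mul_mem_periodLatticeGamma1`), and the abstract lemma `exists_generator_of_forall_prime`.
[cite: Hungerford1974, Ch. II Thm. 1.6 and Ch. IV Thm. 6.1] [cite: Shimura1971, Thm. 7.14] [cite: LingOesterle1991, §1 and Thm. 1] -/
theorem cyclic_of_forall_prime_not_le (hf : IsNewform0 f) (hQ : coeffField f = ⊥)
    (h : ∀ ℓ : ℕ, ℓ.Prime → ¬ (∀ z ∈ periodLatticeGamma1 f, ∃ w ∈ periodLattice f, z = (ℓ : ℂ) * w)) :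
    ∃ z₀ ∈ periodLattice f, ∀ z ∈ periodLattice f, ∃ (k : ℤ) (w : ℂ), w ∈ periodLatticeGamma1 f ∧ z = (k : ℂ) * z₀ + w := by
  classical
  obtain ⟨hdisc, hZ⟩ := isZLattice_periodLattice_holds (f := f) hf hQ
  haveI : DiscreteTopology ↥(AddSubgroup.toIntSubmodule (periodLattice f)) := hdisc
  haveI : IsZLattice ℝ (AddSubgroup.toIntSubmodule (periodLattice f)) := hZ
  haveI : Module.Free ℤ ↥(AddSubgroup.toIntSubmodule (periodLattice f)) :=
    ZLattice.module_free ℝ (AddSubgroup.toIntSubmodule (periodLattice f))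
  haveI : Module.Finite ℤ ↥(AddSubgroup.toIntSubmodule (periodLattice f)) :=
    ZLattice.module_finite ℝ (AddSubgroup.toIntSubmodule (periodLattice f))
  have hrank : Module.finrank ℤ ↥(AddSubgroup.toIntSubmodule (periodLattice f)) = 2 := by
    rw [ZLattice.rank ℝ (AddSubgroup.toIntSubmodule (periodLattice f)), Complex.finrank_real_complex]
  -- `Λ₁(f)` pulled back into the lattice `Λ₀(f)`
  let N₁ : Submodule ℤ ↥(AddSubgroup.toIntSubmodule (periodLattice f)) :=
    (AddSubgroup.toIntSubmodule (periodLatticeGamma1 f)).comap (AddSubgroup.toIntSubmodule (periodLattice f)).subtype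
  have hN₁ : ∀ x : ↥(AddSubgroup.toIntSubmodule (periodLattice f)), x ∈ N₁ ↔ (x : ℂ) ∈ periodLatticeGamma1 f := fun _ ↦
    Iff.rfl
  have hcoe : ∀ (m : ℤ) (x : ↥(AddSubgroup.toIntSubmodule (periodLattice f))),
      (((m • x : ↥(AddSubgroup.toIntSubmodule (periodLattice f))) : ℂ)) = (m : ℂ) * (x : ℂ) := fun m x ↦ by
    simp [zsmul_eq_mul]
  -- hypotheses of the abstract lemma with `n = φ(N)`
  have hφ0 : (Nat.totient N : ℂ) ≠ 0 := by exact_mod_cast (Nat.totient_pos.mpr (NeZero.pos N)).ne'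
  have hinj : Function.Injective fun x : ↥(AddSubgroup.toIntSubmodule (periodLattice f)) ↦ (Nat.totient N : ℤ) • x := by
    intro x y hxy
    have hxy' := congrArg (fun v : ↥(AddSubgroup.toIntSubmodule (periodLattice f)) ↦ (v : ℂ)) hxy
    simp only [hcoe, Int.cast_natCast] at hxy'
    exact Subtype.ext (mul_left_cancel₀ hφ0 hxy')
  have hnM : ∀ x : ↥(AddSubgroup.toIntSubmodule (periodLattice f)), (Nat.totient N : ℤ) • x ∈ N₁ := fun x ↦ by
    rw [hN₁, hcoe, Int.cast_natCast]
    exact totient_mul_mem_periodLatticeGamma1 f x.2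
  have h' : ∀ ℓ : ℕ, ℓ.Prime → ∃ x ∈ N₁, ∀ y : ↥(AddSubgroup.toIntSubmodule (periodLattice f)), x ≠ (ℓ : ℤ) • y := by
    intro ℓ hℓ
    by_contra hcon
    push Not at hcon
    refine h ℓ hℓ fun z hz ↦ ?_
    obtain ⟨y, hy⟩ := hcon ⟨z, periodLatticeGamma1_le_periodLattice f hz⟩ ((hN₁ _).mpr hz)
    refine ⟨(y : ℂ), y.2, ?_⟩
    have := congrArg (fun v : ↥(AddSubgroup.toIntSubmodule (periodLattice f)) ↦ (v : ℂ)) hy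
    simpa [hcoe] using this
  obtain ⟨z₀, hz₀⟩ := exists_generator_of_forall_prime hrank N₁ hinj hnM h'
  refine ⟨(z₀ : ℂ), z₀.2, fun z hz ↦ ?_⟩
  obtain ⟨k, hk⟩ := hz₀ ⟨z, hz⟩
  refine ⟨k, (((⟨z, hz⟩ - k • z₀ : ↥(AddSubgroup.toIntSubmodule (periodLattice f))) : ℂ)), (hN₁ _).mp hk, ?_⟩
  simp [hcoe]

/-- **The dichotomy** (E-es-190 both ways): `Λ₀(f)/Λ₁(f)` is cyclic iff no prime `ℓ` has `Λ₁(f) ⊆ ℓΛ₀(f)`. [cite: Hungerford1974, Ch. IV Thm. 6.1] -/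
theorem cyclic_iff_forall_prime_not_le (hf : IsNewform0 f) (hQ : coeffField f = ⊥) :
    (∃ z₀ ∈ periodLattice f, ∀ z ∈ periodLattice f, ∃ (k : ℤ) (w : ℂ), w ∈ periodLatticeGamma1 f ∧ z = (k : ℂ) * z₀ + w) ↔
      ∀ ℓ : ℕ, ℓ.Prime → ¬ (∀ z ∈ periodLatticeGamma1 f, ∃ w ∈ periodLattice f, z = (ℓ : ℂ) * w) :=
  ⟨fun ⟨_, hz₀, hcyc⟩ _ hℓ ↦ not_prime_le_of_cyclic f hf hQ hz₀ hcyc hℓ, cyclic_of_forall_prime_not_le f hf hQ⟩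

/-! ## §3 Datum forms and the glue to desc row 2 -/

variable {W₀ : WeierstrassCurve ℚ} (D₀ : ModularParametrizationData W₀ N)

/-- **Datum form of E-es-190**: for every modular parametrisation datum, if no prime `ℓ` has `Λ₁(f) ⊆ ℓΛ₀(f)` (`f = D₀.f`, a rational newform by
`D₀.isNewformOf`), then `Λ₀(f) = ℤz₀ + Λ₁(f)` — verbatim the body of desc's `ShimuraCyclic.ShimuraKernelCyclic` at `D₀`. [cite: Hungerford1974, Ch. IV Thm. 6.1] -/
theorem cyclic_of_forall_prime_not_le_datum
    (h : ∀ ℓ : ℕ, ℓ.Prime → ¬ (∀ z ∈ periodLatticeGamma1 D₀.f, ∃ w ∈ periodLattice D₀.f, z = (ℓ : ℂ) * w)) :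
    ∃ z₀ ∈ periodLattice D₀.f, ∀ z ∈ periodLattice D₀.f, ∃ (k : ℤ) (w : ℂ), w ∈ periodLatticeGamma1 D₀.f ∧ z = (k : ℂ) * z₀ + w :=
  cyclic_of_forall_prime_not_le D₀.f D₀.isNewformOf.1 (IsNewformOf.coeffField_eq_bot D₀.isNewformOf) h

/-- The datum form of the parity lemma: `Λ₀ = ℤz₀ + Λ₁` at `D₀.f` excludes every prime inclusion `Λ₁ ⊆ ℓΛ₀`. [cite: Shimura1971, Thm. 7.14] -/
theorem not_prime_le_of_cyclic_datum {z₀ : ℂ} (hz₀ : z₀ ∈ periodLattice D₀.f)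
    (hcyc : ∀ z ∈ periodLattice D₀.f, ∃ (k : ℤ) (w : ℂ), w ∈ periodLatticeGamma1 D₀.f ∧ z = (k : ℂ) * z₀ + w)
    {ℓ : ℕ} (hℓ : ℓ.Prime) : ¬ (∀ z ∈ periodLatticeGamma1 D₀.f, ∃ w ∈ periodLattice D₀.f, z = (ℓ : ℂ) * w) :=
  not_prime_le_of_cyclic D₀.f D₀.isNewformOf.1 (IsNewformOf.coeffField_eq_bot D₀.isNewformOf) hz₀ hcyc hℓ

/-- **Desc row 2's body from its two parts**: «`Λ₁ ⊄ 2Λ₀`» (the `2`-part, E-es-188; p3's `KummerValues.not_halfIndex_of_modularity_of_kummerValues`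
supplies it from the Kummer values) and «`Λ₁ ⊄ ℓΛ₀` for every odd prime `ℓ`» (the odd part, E-es-189) give `Λ₀(f) = ℤz₀ + Λ₁(f)` at `D₀.f`.
Nothing about the parts themselves is proved here. [cite: Hungerford1974, Ch. IV Thm. 6.1] -/
theorem shimuraKernelCyclic_body_of_parts
    (h2 : ¬ (∀ z ∈ periodLatticeGamma1 D₀.f, ∃ w ∈ periodLattice D₀.f, z = 2 * w))
    (hodd : ∀ ℓ : ℕ, ℓ.Prime → ℓ ≠ 2 → ¬ (∀ z ∈ periodLatticeGamma1 D₀.f, ∃ w ∈ periodLattice D₀.f, z = (ℓ : ℂ) * w)) :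
    ∃ z₀ ∈ periodLattice D₀.f, ∀ z ∈ periodLattice D₀.f, ∃ (k : ℤ) (w : ℂ), w ∈ periodLatticeGamma1 D₀.f ∧ z = (k : ℂ) * z₀ + w := by
  refine cyclic_of_forall_prime_not_le_datum D₀ fun ℓ hℓ ↦ ?_
  by_cases h : ℓ = 2
  · subst h; exact_mod_cast h2
  · exact hodd ℓ hℓ h

/-- **Row-level glue**: the `f`-only row «no prime inclusion for rational newforms» ⟹ desc's `NewformShimuraKernelCyclic` (hence
`ShimuraKernelCyclic`, `Gamma1PeriodsNotInsideTwiceGamma0Periods`, E-an-152b by desc's proved glue). [cite: Hungerford1974, Ch. IV Thm. 6.1] -/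
theorem newformShimuraKernelCyclic_of_forall_prime_not_le
    (h : ∀ {N : ℕ} [NeZero N] (f : CuspForm (Gamma0 N) 2), IsNewform0 f → coeffField f = ⊥ →
      ∀ ℓ : ℕ, ℓ.Prime → ¬ (∀ z ∈ periodLatticeGamma1 f, ∃ w ∈ periodLattice f, z = (ℓ : ℂ) * w)) :
    Summit.BirchSwinnertonDyer.Rank1Residual.ManinAdditive.ShimuraCyclic.NewformShimuraKernelCyclic :=
  fun f hf hQ ↦ cyclic_of_forall_prime_not_le f hf hQ (h f hf hQ)

end Summit.BirchSwinnertonDyer.BirchSwinnertonDyer.Theorems.ManinLocalTwoThree.ShimuraKernelLattice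

end
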